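import Summits.ABC.IUTFork.Conditional.WRowFrey73AllLevels
import Summits.ABC.IUTFork.Conditional.WRowFrey301327048AllLevels
import Summits.ABC.IUTFork.Conditional.AbcOfSGenuineKLicence
import Summits.ABC.IUTFork.Cor312ThetaSideClosedK
import Summits.ABC.IUTFork.Cor312SettingDHVolWitness
import Summits.ABC.IUTFork.Cor312ProvKIdeles
import HarnessLib

/-!
# Branch C — the NUMBER-LEVEL typed [IUTchIII] Cor. 3.12 in READING (U) (`T.Cor312Of`) TRUE, NO hypothesis, at EVERY genuine Θ-volume datum of the
# «W:INHABITED-BANDS-B» triples AT EVERY (high enough) PRIME LEVEL: `73 + 2¹³·7⁷·941² = 3¹⁶·103³·127` (all `l ≥ 29`), `1 + 3¹⁶·7 = 2³·11·23·53³` (all `l ≥ 11`)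

C scoreboard (abc-iut-C-cert-3 gen 4, INTAKE / CERTS pen). PROOF-ONLY junction file (no `def`, no new `Prop`, no instance, no notation; nothing
re-typed); part B of `AbcOfSCor312OfAllLevels` (p489045; same recipe, same words). Inputs BY NAME: abc-iut-W-row-2 gen 2's `WRow.licence_frey73_all`
(p488605) and `WRow.licence_frey301327048_all` over abc-iut-W-row-1's socket `WRow.licence_triple_unconditional` (p485974); abc-iut-C-cert-3's
`GenuineK.cor312Of_of_licence` (p435505); abc-iut-s2-p6's `negLogTheta_settingPrVolSharp_pilotDataOfK_le_datum` (p447368); one-point context data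
(abc-iut-c312-7's `unitSigDH/unitSplitDH/unitQDataDH/unitLatticeDH`, `M := ℚ`); realising ideles `Cor312Prov.exists_realising_{q,theta}Ideles_pilotDataOfK`.

READING (numbers, no side): LINE-FREE — `T.Cor312Of` is what the K and the M number binders of the window certificates demand at T; on these two
(λ, l)-families those binder instances are theorems. Stronger reading than §O's per-image (P) form; NO height bound follows (display constant ≈ 10⁸
nats; cone binder `hregBad` untouched, C-R52); not a claim that abc is proved or refuted; no side on any author; inhabited-as-typed ≠ true-in-print;
typed ≠ proved; instantiated ≠ endorsed. [cite: Mochizuki2012, IUTchIII Cor. 3.12 p. 173–174, Step (xi-f) p. 184; IUTchIV Thm. 1.10 p. 22–23,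
Cor. 2.2 (ii) proof (P5)(P7) p. 46; IUTchI Ex. 3.2 (iv) p. 71] [cite: DupuyHilado2025, §3.3, §3.4] [claim: Mochizuki2012, status: disputed]
-/

noncomputable section

open Set Function NumberField IsDedekindDomain

namespace Summit.ABC.IUTFork.Conditional

open Thm311 Thm311.Real Cor312 Cor312Vol Cor312Prov Literature.IUT.LogThetaLattice Literature.IUT.LogVolume
  Literature.IUT.HodgeTheaters Literature.IUT.LogVolume.ThetaData Literature.IUT.LogVolume.Cor22
open Literature.NumberTheory.NumberFields Literature.NumberTheory.GaloisRepresentations.Ultrametric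
open Literature.NumberTheory.DiophantineGeometry Literature.NumberTheory.DiophantineGeometry.GenEll Summit.ABC.ABC.Theorems

/-- **`T.Cor312Of` at EVERY genuine Θ-volume datum over `(ratPoint (73/5973865915867209), l)` for EVERY prime `l ≥ 29`, NO hypothesis** — the abc
triple `73 + 2¹³·7⁷·941² = 3¹⁶·103³·127` («W:INHABITED-BANDS-B», abc-iut-W-row-2's `WRow.licence_frey73_all`, p488605) through `GenuineK.cor312Of_of_licence`
(p435505) + the Θ-descent p447368. [cite: Mochizuki2012, IUTchIII Cor. 3.12 p. 173–174; IUTchIV Cor. 2.2 (ii) proof (P5) p. 46] [claim: Mochizuki2012, status: disputed] -/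
theorem Frey73.cor312Of_all (l : ℕ) (hl : l.Prime) (hl0 : 29 ≤ l) (T : Cor22.ThetaVolumeDatumAt (ratPoint (((73 : ℕ) : ℚ) / (5973865915867209 : ℕ))) l) : T.Cor312Of := by
  letI := T.instFieldF; letI := T.instNumberFieldF; letI := T.instAlgebraF; letI := T.instFieldK
  letI := T.instNumberFieldK; letI := T.instAlgebraK; letI := T.instFieldFbar; letI := T.instAlgebraFbar
  letI := T.instAlgebraKFbar; letI := T.instIsElliptic
  obtain ⟨tq, htq0, htq1, htq⟩ := exists_realising_qIdeles_pilotDataOfK T.D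
  obtain ⟨t, ht0, ht1, ht⟩ := exists_realising_thetaIdeles_pilotDataOfK T.D
  exact GenuineK.cor312Of_of_licence T.D T.K ℚ (fun _ _ => ∅) (fun _ _ => ∅) (fun _ _ _ => ∅) (fun _ _ _ => 0) (fun _ _ => ∅)
    (fun _ _ _ _ => ∅) 0 unitLatticeDH (unitSigDH (pilotDataOfK T.D T.K)) (unitSplitDH (pilotDataOfK T.D T.K))
    (unitQDataDH (pilotDataOfK T.D T.K)) t tq T.isVolumeInputOf htq0 htq1 ht0 ht1 htq
    (WRow.licence_frey73_all l hl hl0 T (logvAnalytic_analyticLogv (F := T.K)) ℚ (fun _ _ => ∅) (fun _ _ => ∅) (fun _ _ _ => ∅)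
      (fun _ _ _ => 0) (fun _ _ => ∅) (fun _ _ _ _ => ∅) 0 unitLatticeDH (unitSigDH (pilotDataOfK T.D T.K)) (unitSplitDH (pilotDataOfK T.D T.K))
      (unitQDataDH (pilotDataOfK T.D T.K)) tq t htq0 htq1 ht0 ht htq)
    (negLogTheta_settingPrVolSharp_pilotDataOfK_le_datum T ℚ (fun _ _ => ∅) (fun _ _ => ∅) (fun _ _ _ => ∅) (fun _ _ _ => 0) (fun _ _ => ∅)
      (fun _ _ _ _ => ∅) 0 unitLatticeDH (unitSigDH (pilotDataOfK T.D T.K)) (unitSplitDH (pilotDataOfK T.D T.K)) (unitQDataDH (pilotDataOfK T.D T.K))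
      tq t htq0 htq1 ht0 ht)

/-- **`T.Cor312Of` at EVERY genuine Θ-volume datum over `(ratPoint (1/301327048), l)` for EVERY prime `l ≥ 11`, NO hypothesis** — the abc triple
`1 + 3¹⁶·7 = 2³·11·23·53³` («W:INHABITED-BANDS-B», abc-iut-W-row-2's `WRow.licence_frey301327048_all`) through `GenuineK.cor312Of_of_licence` + p447368
(supersedes the single level 23 of p484566). [cite: Mochizuki2012, IUTchIII Cor. 3.12 p. 173–174; IUTchIV Cor. 2.2 (ii) proof (P5) p. 46]
[claim: Mochizuki2012, status: disputed] -/
theorem Frey301327048.cor312Of_all (l : ℕ) (hl : l.Prime) (hl0 : 11 ≤ l) (T : Cor22.ThetaVolumeDatumAt (ratPoint (((1 : ℕ) : ℚ) / (301327048 : ℕ))) l) : T.Cor312Of := by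
  letI := T.instFieldF; letI := T.instNumberFieldF; letI := T.instAlgebraF; letI := T.instFieldK
  letI := T.instNumberFieldK; letI := T.instAlgebraK; letI := T.instFieldFbar; letI := T.instAlgebraFbar
  letI := T.instAlgebraKFbar; letI := T.instIsElliptic
  obtain ⟨tq, htq0, htq1, htq⟩ := exists_realising_qIdeles_pilotDataOfK T.D
  obtain ⟨t, ht0, ht1, ht⟩ := exists_realising_thetaIdeles_pilotDataOfK T.D
  exact GenuineK.cor312Of_of_licence T.D T.K ℚ (fun _ _ => ∅) (fun _ _ => ∅) (fun _ _ _ => ∅) (fun _ _ _ => 0) (fun _ _ => ∅)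
    (fun _ _ _ _ => ∅) 0 unitLatticeDH (unitSigDH (pilotDataOfK T.D T.K)) (unitSplitDH (pilotDataOfK T.D T.K))
    (unitQDataDH (pilotDataOfK T.D T.K)) t tq T.isVolumeInputOf htq0 htq1 ht0 ht1 htq
    (WRow.licence_frey301327048_all l hl hl0 T (logvAnalytic_analyticLogv (F := T.K)) ℚ (fun _ _ => ∅) (fun _ _ => ∅) (fun _ _ _ => ∅)
      (fun _ _ _ => 0) (fun _ _ => ∅) (fun _ _ _ _ => ∅) 0 unitLatticeDH (unitSigDH (pilotDataOfK T.D T.K)) (unitSplitDH (pilotDataOfK T.D T.K))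
      (unitQDataDH (pilotDataOfK T.D T.K)) tq t htq0 htq1 ht0 ht htq)
    (negLogTheta_settingPrVolSharp_pilotDataOfK_le_datum T ℚ (fun _ _ => ∅) (fun _ _ => ∅) (fun _ _ _ => ∅) (fun _ _ _ => 0) (fun _ _ => ∅)
      (fun _ _ _ _ => ∅) 0 unitLatticeDH (unitSigDH (pilotDataOfK T.D T.K)) (unitSplitDH (pilotDataOfK T.D T.K)) (unitQDataDH (pilotDataOfK T.D T.K))
      tq t htq0 htq1 ht0 ht)

end Summit.ABC.IUTFork.Conditional

end
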